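import Mathlib
import HarnessLib
import Summits.NavierStokesRegularity.NavierStokesRegularity.Theorems.UnthreadedDoorKinematicShadowZonalFrame
import Summits.NavierStokesRegularity.NavierStokesRegularity.Theorems.ThreadingFluxHorizonTowerProfileCurlT1

/-!
# Route `UnthreadedDoor`, crux `PoloidalLiouville` (stmt-NavierStokesRegularity-1222), WALL W1 — crux idea «kinematic-shadow»
# (ns-idea-15, `Cruxes/PoloidalLiouville/KinematicShadowSketch.lean` v1.2): zonal sub-rung A_z, Stage 2b — AZIMUTHAL KINEMATICS
# (rotation about the axis; `∂_φ u_φ = 0` for a divergence-free field with zonal meridian components)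

ARM A (ns-exp-scalarLiouville g5), KEY-NS 02:19Z (2); item R5 of ns-qj-p1's BLUEPRINT-kinematic-shadow-Az.  Frame `(e_r, e_θ, b)` of
`UnthreadedDoorKinematicShadowZonalFrame` (`b = e × n`); the azimuthal circle is parametrised by the unit vector
`n_φ = cos φ n + sin φ b ⊥ e` (with `e × n_φ = cos φ b − sin φ n`) and the spherical chart
`S(r, θ, φ) = x₀ + r (cos θ e + sin θ n_φ)`.
* `hasDerivAt_chart_azimuth` — `∂_φ S = (r sin θ)(e × n_φ) = e × (S − x₀)` (`cross_axis_chart`);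
* ★ `comp_chart_azimuth_eq` — a scalar `F`, differentiable on the shell `{R < ‖x − x₀‖}` with `⟪∇F(x), e × (x − x₀)⟫ = 0` there, is
  constant on azimuthal circles: `F(S(r,θ,φ)) = F(S(r,θ,0))` (this is how the components (i), (ii) of the steady law —
  `KinematicShadow.zonalLaw_components` — are used);
* `hasDerivAt_radial_component`, `hasDerivAt_polar_component`, `hasDerivAt_azimuthal_component` — the frame components of `Du` as
  one-variable derivatives of `u_r`, `u_θ`, `u_φ` along the coordinate lines; `divergence_chart` — `div u` in the frame at `S`;
* ★ `azimuthal_strain_eq` — for `u ∈ C¹` divergence free whose meridian components `u_r`, `u_θ` (taken in the rotating frame) do not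
  depend on `φ`, the azimuthal strain is the curvature term only: `(r sin θ) ⟪Du(X) b, b⟫ = ⟪u(X), n⟫` at `X = S(r,θ,0)`, `r ≠ 0`,
  i.e. `∂_φ u_φ = 0` — by `2π`-periodicity of `φ ↦ u_φ` whose derivative is `φ`-independent.

HONEST LABEL: kinematics for an information-grade no-go in the LINEAR kinematic shadow (critic V20); 1222 / W1 / NS regularity OPEN;
nothing here is an NS statement.  `--supports stmt-NavierStokesRegularity-1222 --as helper`.
-/

noncomputable section

-- the summit and its single sub-problem share the name (CONVENTIONS §1)
set_option linter.dupNamespace false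

open Set Function Filter Topology InnerProductSpace
open scoped RealInnerProductSpace

namespace Summit.NavierStokesRegularity.NavierStokesRegularity.Theorems.PoloidalLiouville.KinematicShadow

open Literature.Analysis Literature.Analysis.FluidPDE
open Summit.NavierStokesRegularity.NavierStokesRegularity.Theorems.PoloidalLiouville.NetFlux (E3)
open Summit.NavierStokesRegularity.NavierStokesRegularity.Theorems.PoloidalLiouville.HorizonTower.Zonal
  (inner_cross_self_left)

variable {x₀ e n : E3}

/-! ### The azimuthal unit vector `n_φ = cos φ n + sin φ (e × n)` -/

/-- `e ⊥ e × n`. [folklore] -/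
theorem inner_self_cross_left (e n : E3) : ⟪e, cross e n⟫ = 0 := by
  rw [real_inner_comm]; exact inner_cross_self_left e n

/-- `e ⊥ n_φ`. [folklore] -/
theorem inner_axis_azimuthVec (hen : ⟪e, n⟫ = 0) (φ : ℝ) : ⟪e, Real.cos φ • n + Real.sin φ • cross e n⟫ = 0 := by
  simp [inner_add_right, real_inner_smul_right, hen, inner_self_cross_left]

/-- `‖n_φ‖ = 1`. [folklore] -/
theorem norm_azimuthVec (he : ‖e‖ = 1) (hn : ‖n‖ = 1) (hen : ⟪e, n⟫ = 0) (φ : ℝ) :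
    ‖Real.cos φ • n + Real.sin φ • cross e n‖ = 1 :=
  norm_polarVec hn (norm_cross_of_orthonormal he hn hen) (HorizonTower.inner_cross_self_right e n) φ

/-- `e × n_φ = cos φ (e × n) − sin φ n`. [folklore] -/
theorem cross_axis_azimuthVec (he : ‖e‖ = 1) (hen : ⟪e, n⟫ = 0) (φ : ℝ) :
    cross e (Real.cos φ • n + Real.sin φ • cross e n) = Real.cos φ • cross e n - Real.sin φ • n := by
  rw [PointSource.cross_add_right, PointSource.cross_smul_right, PointSource.cross_smul_right,
    cross_self_cross_of_orthonormal he hen, smul_neg, sub_eq_add_neg]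

/-- **Azimuthal velocity of the chart**: `∂_φ S(r,θ,φ) = (r sin θ)(cos φ (e × n) − sin φ n)`. [folklore] -/
theorem hasDerivAt_chart_azimuth (x₀ e n : E3) (r θ φ : ℝ) :
    HasDerivAt (fun φ : ℝ => x₀ + r • (Real.cos θ • e + Real.sin θ • (Real.cos φ • n + Real.sin φ • cross e n)))
      ((r * Real.sin θ) • (Real.cos φ • cross e n - Real.sin φ • n)) φ := by
  have h := (((hasDerivAt_polarVec n (cross e n) φ).const_smul (Real.sin θ)).const_add (Real.cos θ • e)).const_smul r
    |>.const_add x₀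
  exact h.congr_deriv (by rw [smul_smul])

/-- The azimuthal velocity is the rotation field: `∂_φ S = e × (S − x₀)`. [folklore] -/
theorem cross_axis_chart_azimuth (he : ‖e‖ = 1) (hen : ⟪e, n⟫ = 0) (r θ φ : ℝ) :
    cross e (x₀ + r • (Real.cos θ • e + Real.sin θ • (Real.cos φ • n + Real.sin φ • cross e n)) - x₀) =
      (r * Real.sin θ) • (Real.cos φ • cross e n - Real.sin φ • n) := by
  rw [cross_axis_chart, cross_axis_azimuthVec he hen]

/-! ### Rotation invariance from a vanishing azimuthal derivative -/

/-- A scalar field whose gradient is orthogonal to the rotation field `e × (x − x₀)` on the shell `{R < ‖x − x₀‖}` has vanishing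
derivative along every azimuthal circle of the shell. [folklore] -/
theorem hasDerivAt_comp_chart_azimuth {F : E3 → ℝ} {R : ℝ} (he : ‖e‖ = 1) (hn : ‖n‖ = 1) (hen : ⟪e, n⟫ = 0) (hR : 0 ≤ R)
    (hF : ∀ x : E3, R < ‖x - x₀‖ → DifferentiableAt ℝ F x)
    (hK : ∀ x : E3, R < ‖x - x₀‖ → ⟪gradient F x, cross e (x - x₀)⟫ = 0) {r : ℝ} (hr : R < r) (θ φ : ℝ) :
    HasDerivAt (fun φ : ℝ => F (x₀ + r • (Real.cos θ • e + Real.sin θ • (Real.cos φ • n + Real.sin φ • cross e n)))) 0 φ := by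
  have hr0 : 0 < r := hR.trans_lt hr
  set S : E3 := x₀ + r • (Real.cos θ • e + Real.sin θ • (Real.cos φ • n + Real.sin φ • cross e n)) with hSdef
  have hS : R < ‖S - x₀‖ := by
    rw [hSdef, norm_chart_sub (norm_polarVec he (norm_azimuthVec he hn hen φ) (inner_axis_azimuthVec hen φ) θ) hr0.le]
    exact hr
  have h := hasDerivAt_comp_curve (hF S hS) (hasDerivAt_chart_azimuth x₀ e n r θ φ)
  have h0 : ⟪gradient F S, (r * Real.sin θ) • (Real.cos φ • cross e n - Real.sin φ • n)⟫ = 0 := by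
    rw [← cross_axis_chart_azimuth he hen r θ φ]
    exact hK S hS
  rw [h0] at h
  exact h

/-- ★ **Rotation invariance**: under the hypotheses of `hasDerivAt_comp_chart_azimuth`, `F` is constant on the azimuthal circles of
the shell: `F(S(r,θ,φ)) = F(S(r,θ,0)) = F(x₀ + r e_r(θ))`. [folklore] -/
theorem comp_chart_azimuth_eq {F : E3 → ℝ} {R : ℝ} (he : ‖e‖ = 1) (hn : ‖n‖ = 1) (hen : ⟪e, n⟫ = 0) (hR : 0 ≤ R)
    (hF : ∀ x : E3, R < ‖x - x₀‖ → DifferentiableAt ℝ F x)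
    (hK : ∀ x : E3, R < ‖x - x₀‖ → ⟪gradient F x, cross e (x - x₀)⟫ = 0) {r : ℝ} (hr : R < r) (θ φ : ℝ) :
    F (x₀ + r • (Real.cos θ • e + Real.sin θ • (Real.cos φ • n + Real.sin φ • cross e n))) =
      F (x₀ + r • (Real.cos θ • e + Real.sin θ • n)) := by
  have h := fun ψ => hasDerivAt_comp_chart_azimuth he hn hen hR hF hK hr θ ψ
  have hc := is_const_of_deriv_eq_zero (fun ψ => (h ψ).differentiableAt) (fun ψ => (h ψ).deriv) φ 0
  simpa using hc

/-! ### Frame components of `Du` as derivatives along the coordinate lines -/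

/-- Radial strain: `d/dρ ⟪u(x₀ + ρ v), v⟫ = ⟪Du(x₀ + ρ v) v, v⟫`. [folklore] -/
theorem hasDerivAt_radial_component {u : E3 → E3} (x₀ v : E3) {ρ : ℝ} (hu : DifferentiableAt ℝ u (x₀ + ρ • v)) :
    HasDerivAt (fun ρ : ℝ => ⟪u (x₀ + ρ • v), v⟫) ⟪fderiv ℝ u (x₀ + ρ • v) v, v⟫ ρ := by
  have h := hasDerivAt_inner_field_curve (γ := fun ρ : ℝ => x₀ + ρ • v) (w := fun _ => v) hu
    (hasDerivAt_chart_radius x₀ v ρ) (hasDerivAt_const ρ v)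
  simpa using h

/-- Polar strain: `d/dθ ⟪u(x₀ + r e_r(θ)), e_θ(θ)⟫ = r ⟪Du e_θ, e_θ⟫ − ⟪u, e_r⟫`. [folklore] -/
theorem hasDerivAt_polar_component {u : E3 → E3} (x₀ p q : E3) (r : ℝ) {θ : ℝ}
    (hu : DifferentiableAt ℝ u (x₀ + r • (Real.cos θ • p + Real.sin θ • q))) :
    HasDerivAt (fun θ : ℝ => ⟪u (x₀ + r • (Real.cos θ • p + Real.sin θ • q)), Real.cos θ • q - Real.sin θ • p⟫)
      (r * ⟪fderiv ℝ u (x₀ + r • (Real.cos θ • p + Real.sin θ • q)) (Real.cos θ • q - Real.sin θ • p),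
          Real.cos θ • q - Real.sin θ • p⟫
        - ⟪u (x₀ + r • (Real.cos θ • p + Real.sin θ • q)), Real.cos θ • p + Real.sin θ • q⟫) θ := by
  have h := hasDerivAt_inner_field_curve (γ := fun θ : ℝ => x₀ + r • (Real.cos θ • p + Real.sin θ • q))
    (w := fun θ : ℝ => Real.cos θ • q - Real.sin θ • p) hu (hasDerivAt_chart_angle x₀ p q r θ) (hasDerivAt_polarVec' p q θ)
  refine h.congr_deriv ?_
  rw [map_smul, real_inner_smul_left, inner_neg_right]
  ring

/-- Azimuthal strain: `d/dφ ⟪u(S(r,θ,φ)), e × n_φ⟫ = (r sin θ) ⟪Du (e × n_φ), e × n_φ⟫ − ⟪u, n_φ⟫`. [folklore] -/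
theorem hasDerivAt_azimuthal_component {u : E3 → E3} (x₀ e n : E3) (r θ : ℝ) {φ : ℝ}
    (hu : DifferentiableAt ℝ u (x₀ + r • (Real.cos θ • e + Real.sin θ • (Real.cos φ • n + Real.sin φ • cross e n)))) :
    HasDerivAt (fun φ : ℝ => ⟪u (x₀ + r • (Real.cos θ • e + Real.sin θ • (Real.cos φ • n + Real.sin φ • cross e n))),
        Real.cos φ • cross e n - Real.sin φ • n⟫)
      ((r * Real.sin θ) *
          ⟪fderiv ℝ u (x₀ + r • (Real.cos θ • e + Real.sin θ • (Real.cos φ • n + Real.sin φ • cross e n)))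
              (Real.cos φ • cross e n - Real.sin φ • n), Real.cos φ • cross e n - Real.sin φ • n⟫
        - ⟪u (x₀ + r • (Real.cos θ • e + Real.sin θ • (Real.cos φ • n + Real.sin φ • cross e n))),
            Real.cos φ • n + Real.sin φ • cross e n⟫) φ := by
  have h := hasDerivAt_inner_field_curve
    (γ := fun φ : ℝ => x₀ + r • (Real.cos θ • e + Real.sin θ • (Real.cos φ • n + Real.sin φ • cross e n)))
    (w := fun φ : ℝ => Real.cos φ • cross e n - Real.sin φ • n) hu (hasDerivAt_chart_azimuth x₀ e n r θ φ)
    (hasDerivAt_polarVec' n (cross e n) φ)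
  refine h.congr_deriv ?_
  rw [map_smul, real_inner_smul_left, inner_neg_right]
  ring

/-- `div u` at a chart point in the frame `(e_r, e_θ, e × n)`: for a divergence-free field the three strains sum to zero. [folklore] -/
theorem strain_sum_eq_zero {u : E3 → E3} (hdiv : VectorCalculus.IsDivFree u) (he : ‖e‖ = 1) (hn : ‖n‖ = 1) (hen : ⟪e, n⟫ = 0)
    (θ : ℝ) (x : E3) :
    ⟪fderiv ℝ u x (Real.cos θ • e + Real.sin θ • n), Real.cos θ • e + Real.sin θ • n⟫ +
        ⟪fderiv ℝ u x (Real.cos θ • n - Real.sin θ • e), Real.cos θ • n - Real.sin θ • e⟫ +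
          ⟪fderiv ℝ u x (cross e n), cross e n⟫ = 0 := by
  rw [← divergence_polarFrame he hn hen θ u x]; exact hdiv x

/-! ### `∂_φ u_φ = 0` for a divergence-free field with zonal meridian components -/

/-- `⟪u, n⟫ = sin θ u_r + cos θ u_θ` (frame decomposition of `n`). [folklore] -/
theorem inner_snd_eq_components (v p q : E3) (θ : ℝ) :
    ⟪v, q⟫ = Real.sin θ * ⟪v, Real.cos θ • p + Real.sin θ • q⟫ + Real.cos θ * ⟪v, Real.cos θ • q - Real.sin θ • p⟫ := by
  conv_lhs => rw [snd_eq_polarFrame p q θ]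
  rw [inner_add_right, real_inner_smul_right, real_inner_smul_right]

/-- If a function has the constant derivative `κ` on `ℝ` and takes the same value at `0` and at `2π`, then `κ = 0`. [folklore] -/
theorem eq_zero_of_hasDerivAt_const_of_periodic {G : ℝ → ℝ} {κ : ℝ} (hG : ∀ φ, HasDerivAt G κ φ) (hper : G (2 * Real.pi) = G 0) :
    κ = 0 := by
  have h : ∀ φ, HasDerivAt (fun φ => G φ - κ * φ) 0 φ := fun φ => by
    have h1 : HasDerivAt (fun φ : ℝ => κ * φ) (κ * 1) φ := (hasDerivAt_id φ).const_mul κ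
    have h2 : HasDerivAt (fun φ : ℝ => G φ - κ * φ) (κ - κ * 1) φ := (hG φ).sub h1
    rw [mul_one, sub_self] at h2
    exact h2
  have hc := is_const_of_deriv_eq_zero (fun φ => (h φ).differentiableAt) (fun φ => (h φ).deriv) (2 * Real.pi) 0
  simp only [mul_zero, sub_zero] at hc
  rw [hper] at hc
  have : κ * (2 * Real.pi) = 0 := by linarith
  rcases mul_eq_zero.1 this with h | h
  · exact h
  · exfalso; exact Real.pi_ne_zero (by linarith)

/-- ★ **`∂_φ u_φ = 0`** (azimuthal strain = curvature term).  Let `u ∈ C¹` be divergence free and suppose its meridian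
components in the co-rotating frame do not depend on the azimuth: `u_r(S(ρ,θ,φ)) = u_r(S(ρ,θ,0))` for `ρ` near `r` (all `φ`) and
`u_θ(S(r,ϑ,φ)) = u_θ(S(r,ϑ,0))` for `ϑ` near `θ` (all `φ`).  Then at `X = x₀ + r e_r(θ)`:
`(r sin θ) ⟪Du(X) (e × n), e × n⟫ = ⟪u(X), n⟫`. [folklore] -/
theorem azimuthal_strain_eq {u : E3 → E3} (hu : ContDiff ℝ 1 u) (hdiv : VectorCalculus.IsDivFree u) (he : ‖e‖ = 1)
    (hn : ‖n‖ = 1) (hen : ⟪e, n⟫ = 0) {r θ : ℝ} (hr : r ≠ 0)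
    (hA : ∀ φ : ℝ, (fun ρ : ℝ => ⟪u (x₀ + ρ • (Real.cos θ • e + Real.sin θ • (Real.cos φ • n + Real.sin φ • cross e n))),
        Real.cos θ • e + Real.sin θ • (Real.cos φ • n + Real.sin φ • cross e n)⟫) =ᶠ[𝓝 r]
      fun ρ : ℝ => ⟪u (x₀ + ρ • (Real.cos θ • e + Real.sin θ • n)), Real.cos θ • e + Real.sin θ • n⟫)
    (hB : ∀ φ : ℝ, (fun ϑ : ℝ => ⟪u (x₀ + r • (Real.cos ϑ • e + Real.sin ϑ • (Real.cos φ • n + Real.sin φ • cross e n))),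
        Real.cos ϑ • (Real.cos φ • n + Real.sin φ • cross e n) - Real.sin ϑ • e⟫) =ᶠ[𝓝 θ]
      fun ϑ : ℝ => ⟪u (x₀ + r • (Real.cos ϑ • e + Real.sin ϑ • n)), Real.cos ϑ • n - Real.sin ϑ • e⟫) :
    (r * Real.sin θ) * ⟪fderiv ℝ u (x₀ + r • (Real.cos θ • e + Real.sin θ • n)) (cross e n), cross e n⟫ =
      ⟪u (x₀ + r • (Real.cos θ • e + Real.sin θ • n)), n⟫ := by
  have hud : ∀ x, DifferentiableAt ℝ u x := fun x => hu.differentiable one_ne_zero x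
  set b : E3 := cross e n with hb
  -- the azimuthal frame data
  have hnφ : ∀ φ, ‖Real.cos φ • n + Real.sin φ • b‖ = 1 := norm_azimuthVec he hn hen
  have henφ : ∀ φ, ⟪e, Real.cos φ • n + Real.sin φ • b⟫ = 0 := inner_axis_azimuthVec hen
  -- `u_φ` along the circle and its derivative
  set G : ℝ → ℝ := fun φ =>
    ⟪u (x₀ + r • (Real.cos θ • e + Real.sin θ • (Real.cos φ • n + Real.sin φ • b))), Real.cos φ • b - Real.sin φ • n⟫ with hG
  set κ : ℝ := (r * Real.sin θ) * ⟪fderiv ℝ u (x₀ + r • (Real.cos θ • e + Real.sin θ • n)) b, b⟫ -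
    ⟪u (x₀ + r • (Real.cos θ • e + Real.sin θ • n)), n⟫ with hκ
  -- values at `φ = 0`
  have h0v : Real.cos (0 : ℝ) • n + Real.sin (0 : ℝ) • b = n := by simp
  -- the derivative of `G` at `φ` equals `κ`
  have hGd : ∀ φ, HasDerivAt G κ φ := by
    intro φ
    have h1 := hasDerivAt_azimuthal_component x₀ e n r θ (φ := φ) (hud _)
    -- the strain sum at `S(r,θ,φ)` in the frame of the pair `(e, n_φ)`
    have hsum := strain_sum_eq_zero hdiv he (hnφ φ) (henφ φ) θ
      (x₀ + r • (Real.cos θ • e + Real.sin θ • (Real.cos φ • n + Real.sin φ • b)))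
    rw [cross_axis_azimuthVec he hen] at hsum
    -- the strain sum at `X` in the frame of `(e, n)`
    have hsum0 := strain_sum_eq_zero hdiv he hn hen θ (x₀ + r • (Real.cos θ • e + Real.sin θ • n))
    -- radial strains agree
    have hrad : ⟪fderiv ℝ u (x₀ + r • (Real.cos θ • e + Real.sin θ • (Real.cos φ • n + Real.sin φ • b)))
          (Real.cos θ • e + Real.sin θ • (Real.cos φ • n + Real.sin φ • b)),
          Real.cos θ • e + Real.sin θ • (Real.cos φ • n + Real.sin φ • b)⟫ =
        ⟪fderiv ℝ u (x₀ + r • (Real.cos θ • e + Real.sin θ • n)) (Real.cos θ • e + Real.sin θ • n),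
          Real.cos θ • e + Real.sin θ • n⟫ := by
      have d1 := hasDerivAt_radial_component x₀ (Real.cos θ • e + Real.sin θ • (Real.cos φ • n + Real.sin φ • b)) (ρ := r)
        (hud _)
      have d0 := hasDerivAt_radial_component x₀ (Real.cos θ • e + Real.sin θ • n) (ρ := r) (hud _)
      exact d1.unique (d0.congr_of_eventuallyEq (hA φ))
    -- polar strains agree
    have hAval : ⟪u (x₀ + r • (Real.cos θ • e + Real.sin θ • (Real.cos φ • n + Real.sin φ • b))),
          Real.cos θ • e + Real.sin θ • (Real.cos φ • n + Real.sin φ • b)⟫ =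
        ⟪u (x₀ + r • (Real.cos θ • e + Real.sin θ • n)), Real.cos θ • e + Real.sin θ • n⟫ :=
      (hA φ).self_of_nhds
    have hBval : ⟪u (x₀ + r • (Real.cos θ • e + Real.sin θ • (Real.cos φ • n + Real.sin φ • b))),
          Real.cos θ • (Real.cos φ • n + Real.sin φ • b) - Real.sin θ • e⟫ =
        ⟪u (x₀ + r • (Real.cos θ • e + Real.sin θ • n)), Real.cos θ • n - Real.sin θ • e⟫ :=
      (hB φ).self_of_nhds
    have hpol : ⟪fderiv ℝ u (x₀ + r • (Real.cos θ • e + Real.sin θ • (Real.cos φ • n + Real.sin φ • b)))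
          (Real.cos θ • (Real.cos φ • n + Real.sin φ • b) - Real.sin θ • e),
          Real.cos θ • (Real.cos φ • n + Real.sin φ • b) - Real.sin θ • e⟫ =
        ⟪fderiv ℝ u (x₀ + r • (Real.cos θ • e + Real.sin θ • n)) (Real.cos θ • n - Real.sin θ • e),
          Real.cos θ • n - Real.sin θ • e⟫ := by
      have d1 := hasDerivAt_polar_component x₀ e (Real.cos φ • n + Real.sin φ • b) r (θ := θ) (hud _)
      have d0 := hasDerivAt_polar_component x₀ e n r (θ := θ) (hud _)
      have heq := d1.unique (d0.congr_of_eventuallyEq (hB φ))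
      rw [hAval] at heq
      exact mul_left_cancel₀ hr (sub_left_injective heq)
    -- the curvature term agrees
    have hcurv : ⟪u (x₀ + r • (Real.cos θ • e + Real.sin θ • (Real.cos φ • n + Real.sin φ • b))),
          Real.cos φ • n + Real.sin φ • b⟫ = ⟪u (x₀ + r • (Real.cos θ • e + Real.sin θ • n)), n⟫ := by
      rw [inner_snd_eq_components _ e (Real.cos φ • n + Real.sin φ • b) θ, inner_snd_eq_components _ e n θ, hAval, hBval]
    -- assemble
    refine h1.congr_deriv ?_
    rw [hκ, hcurv]
    congr 1
    have e1 : ⟪fderiv ℝ u (x₀ + r • (Real.cos θ • e + Real.sin θ • (Real.cos φ • n + Real.sin φ • b)))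
          (Real.cos φ • b - Real.sin φ • n), Real.cos φ • b - Real.sin φ • n⟫ =
        ⟪fderiv ℝ u (x₀ + r • (Real.cos θ • e + Real.sin θ • n)) b, b⟫ := by
      linarith [hsum, hsum0, hrad, hpol]
    rw [e1]
  -- periodicity
  have hper : G (2 * Real.pi) = G 0 := by simp [hG]
  have hκ0 := eq_zero_of_hasDerivAt_const_of_periodic hGd hper
  rw [hκ] at hκ0
  linarith

end Summit.NavierStokesRegularity.NavierStokesRegularity.Theorems.PoloidalLiouville.KinematicShadow

end
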